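import Mathlib
import HarnessLib
import Summits.Ventures.LatticeQCDFlow.Exactness.SphereLuscherLocalTermBounds
import Summits.Ventures.LatticeQCDFlow.Exactness.LatticeLocalSumVariance

/-!
# Extensivity of Lüscher's flow-action series for the lattice CP(N−1)/O(N) model: `Var_π̄(S̃⁽ᵏ⁾) ≤ |Λ|·C_k` with `C_k` independent of the volume, and volume-independent per-site bounds on the order-`k` generator

HONEST FRAMING: exact (Metropolis-corrected) sampling algorithms for lattice gauge theory;
figures of merit are autocorrelation/cost numbers at stated couplings and volumes; no
continuum-physics claim.

Venture `LatticeQCDFlow` (cell pub-lqcd), topic `Exactness`; FANOUT row 7 (`s0-cpn-null`: the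
S0-D1 rung — 2D CP⁹, Lüscher's LO trivializing map inside HMC, Engel–Schaefer 2011).  NEW WORK of
the cell over the tree's `Exactness/SphereLuscherLocalTermBounds.lean` (this leg:
`Var_π̄(X_n⁽ᵏ⁾) ≤ (κυ)^{2(k+1)}·A_k(d,Δ)` for the local terms, the force bound `‖∂̃S‖ ≤ 2|κ|υ`),
`Exactness/LatticeLocalSumVariance.lean` (this leg: `Var(Σ_n F_n) ≤ |Λ|·(Δ+1)^{2r}·b` for local
functionals of a product measure, symmetric balls), `Exactness/SphereLuscherRecursionVariance.lean`
(Bernstein under `π̄`), `Exactness/SphereLuscherSeriesLocality(ES).lean` (GEN-9: the local recursion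
`localTerm`, `localSeries_zero_eq/succ_eq`, `esLocalAction`), `Exactness/SphereLuscherSeriesUniqueness.lean`
(`luscher_series_unique`, `siteGrad_eq_of_forall_eq_add_const`) and
`Exactness/SphereLuscherGeneratorLocality.lean` (GEN-9: `nball_symm`, `couplingNbhd_symm` — adjoint
pairs give a SYMMETRIC coupling graph); nothing is cited as a fact.
Printed counterpart, NAMED ONLY: M. Lüscher, Commun. Math. Phys. 293 (2010) 899, §4.4–§4.5 (each
order `S̃⁽ᵏ⁾` of the flow action of the trivializing map is a sum over sites of local terms with
finitely many coefficients per site, uniformly in the lattice size); Engel–Schaefer, Comput. Phys.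
Commun. 182 (2011) 2107, §3 eqs. (13)–(16).  GEN-9 typed locality and the coefficient count ("bounds
on the coefficients / norms of `S̃⁽ᵏ⁾`" NOT CLAIMED); GEN-10's `luscher_generator_norm_equivalence`
compares the generator norm with `Var(S̃⁽ᵏ⁾)` but bounds neither.  THIS FILE: the fluctuation of
EVERY order of EVERY `C²` Lüscher series of the lattice CP(N−1)/O(N) action is at most linear in
`|Λ|`, with a constant depending on the order, `d = dim E`, the coordination number and the coupling
only, and the `L²(π̄)` size of the order-`k` generator `−∂̃_j S̃⁽ᵏ⁾` AT ANY ONE SITE is bounded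
independently of the volume (cell theory question "how must the map scale with VOLUME": at fixed
perturbative order, per site, not at all — now with norms, not only supports and coefficient counts).

## Setting

As in `SphereLuscherLocalTermBounds`: `d = dim E ≥ 2`, `Λ` finite nonempty, `π̄ = ⊗_Λ σ̄`,
`Var(F) = ∫(F − ∫F dπ̄)²dπ̄`; E–S couplings `U` (no self-coupling, adjoint pairs — a SYMMETRIC coupling
graph), weight `Σ_m‖U_{km}‖ ≤ υ`, at most `Δ` partners per site; `S = esAction κ S₀ U`;
`S̃⁽ᵏ⁾ = Σ_n X_n⁽ᵏ⁾` GEN-9's local series; `A_k = localVarConst d Δ k`; `M_k = 2(k+1)`.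

## Content

* §1 `dependsOn_sphereConfig` (an `A`-supported functional read on `Ω` depends only on the `A`-sites),
  `localSeries_mem_polyS` (`S̃⁽ᵏ⁾ ∈ polyS (2(k+1))`), `localSeries_spec` (the assembled local series
  solves Lüscher's recursion for `S` with SOME constants `ċ_k`, packaged as functions of `k`).
* §2 **`variance_localSeries_le`** — `Var_π̄(S̃⁽ᵏ⁾) ≤ |Λ|·(Δ+1)^{2(k+1)}·(κυ)^{2(k+1)}·A_k(d,Δ)`:
  THE ORDER-`k` FLOW ACTION HAS EXTENSIVE FLUCTUATIONS, the constant per site being independent of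
  the volume; **`variance_luscher_series_esAction_le`** — THE SAME FOR EVERY `C²` LÜSCHER SERIES of
  `S` (uniqueness up to constants on `Ω`, GEN-9, and shift-invariance of the variance).
* §3 **`integral_norm_sq_siteGrad_localSeries_le`** — THE GENERATOR PER SITE, UNIFORMLY IN THE VOLUME:
  `∫‖∂̃_j S̃⁽ᵏ⁾‖²dπ̄ ≤ (Δ+1)^{2(k+1)}·M_k(M_k+d−2)·(κυ)^{2(k+1)}·A_k` for every site `j` and every
  finite `Λ` (only the `≤ (Δ+1)^{k+1}` anchors whose footprint contains `j` contribute; Cauchy–Schwarz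
  and the per-anchor Dirichlet bound); `integral_norm_sq_siteGrad_luscher_series_le` — the same for
  every `C²` Lüscher series of `S` (the site gradient on `Ω` only sees the restriction to `Ω`);
  summing over `j` gives the (extensive) total kinetic energy `Σ_j∫‖∂̃_jS̃⁽ᵏ⁾‖² ≤ |Λ|·(that bound)`.

* §4 `sum_opNorm_le_of_ncard_le` (contractive transporters `‖U_{km}‖ ≤ 1` — E–S's U(1) phases —
  have coupling weight `≤ Δ`), **`variance_luscher_series_esAction_le_of_contractive`**,
  **`integral_norm_sq_siteGrad_luscher_series_le_of_contractive`** — the same bounds with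
  `υ = Δ`: constants depending on the order, `d`, the coordination number and `κ` ONLY.

NOT CLAIMED: a lower bound / strict extensivity (no positivity of the variance density); sharpness
in `k`, `Δ` or `d` (the constants grow super-exponentially in `k`: nothing about convergence of
`Σ t^k S̃⁽ᵏ⁾` or any `t > 0`); sup-norm bounds on the generator (the rung's map constant is not
touched); bounds under the interacting measure `e^{−S}dπ`; anything about autocorrelations.
-/

noncomputable section

namespace Summit.Ventures.LatticeQCDFlow.Exactness

open Function Set Metric MeasureTheory NormedSpace InnerProductSpace
open scoped RealInnerProductSpace

variable {Λ : Type*} {E : Type*} [NormedAddCommGroup E] [InnerProductSpace ℝ E]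
  [FiniteDimensional ℝ E] [MeasurableSpace E] [BorelSpace E]

/-! ## §1 Supports read on `Ω`; the assembled local series -/

section Prelim

variable [Fintype Λ] {U : Λ → Λ → (E →L[ℝ] E)}

omit [InnerProductSpace ℝ E] [FiniteDimensional ℝ E] [MeasurableSpace E] [BorelSpace E] [Fintype Λ] in
/-- A functional supported in `A`, read on the product of spheres, depends only on the `A`-sites. -/
theorem dependsOn_sphereConfig {A : Set Λ} {X : (Λ → E) → ℝ} (hX : X ∈ sdepOn A) :
    DependsOn (fun ω : Λ → sphere (0 : E) 1 => X (fun m => (ω m : E))) A :=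
  fun _ _ h => hX fun i hi => by rw [h i hi]

variable [DecidableEq Λ] [Nonempty Λ]

/-- The assembled order-`k` local series `S̃⁽ᵏ⁾ = Σ_n X_n⁽ᵏ⁾` is a lattice polynomial of degree
`≤ 2(k+1)`. -/
theorem localSeries_mem_polyS (h2 : 2 ≤ Module.finrank ℝ E) (hU0 : ∀ n, U n n = 0)
    (hUadj : ∀ m n (v w : E), ⟪U m n v, w⟫ = ⟪v, U n m w⟫) (κ S₀ : ℝ) (k : ℕ) :
    (fun x => ∑ n, localTerm h2 (esLocalAction hU0 hUadj κ S₀) k n x) ∈ polyS Λ E (2 * (k + 1)) := by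
  have e : (fun x => ∑ n, localTerm h2 (esLocalAction hU0 hUadj κ S₀) k n x) =
      ∑ n, localTerm h2 (esLocalAction hU0 hUadj κ S₀) k n := by
    funext x; simp only [Finset.sum_apply]
  rw [e]
  exact Submodule.sum_mem _ fun n _ => (localTerm_mem_es h2 hU0 hUadj κ S₀ k n).1

/-- **The assembled local series solves Lüscher's recursion for `S = esAction κ S₀ U`**, with the
constants `ċ_k` packaged as a function of `k`. -/
theorem localSeries_spec (h2 : 2 ≤ Module.finrank ℝ E) (hU0 : ∀ n, U n n = 0)
    (hUadj : ∀ m n (v w : E), ⟪U m n v, w⟫ = ⟪v, U n m w⟫) (κ S₀ : ℝ) :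
    ∃ c : ℕ → ℝ,
      (∀ ξ : Λ → sphere (0 : E) 1,
        -∑ j, siteLaplacian j (fun x => ∑ n, localTerm h2 (esLocalAction hU0 hUadj κ S₀) 0 n x)
            (fun m => (ξ m : E)) = esAction κ S₀ U (fun m => (ξ m : E)) + c 0) ∧
      (∀ k, ∀ ξ : Λ → sphere (0 : E) 1,
        -∑ j, siteLaplacian j (fun x => ∑ n, localTerm h2 (esLocalAction hU0 hUadj κ S₀) (k + 1) n x)
            (fun m => (ξ m : E)) =
          -(∑ j, ⟪siteGrad j (esAction κ S₀ U) (fun m => (ξ m : E)),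
              siteGrad j (fun x => ∑ n, localTerm h2 (esLocalAction hU0 hUadj κ S₀) k n x)
                (fun m => (ξ m : E))⟫) + c (k + 1)) := by
  set D := esLocalAction hU0 hUadj κ S₀ with hD
  refine ⟨fun k => Nat.casesOn k (Classical.choose (localSeries_zero_eq h2 D))
    fun j => Classical.choose (localSeries_succ_eq h2 D j), fun ξ => ?_, fun k ξ => ?_⟩
  · rw [← esLocalAction_action hU0 hUadj κ S₀]
    exact Classical.choose_spec (localSeries_zero_eq h2 D) ξ
  · rw [← esLocalAction_action hU0 hUadj κ S₀]
    exact Classical.choose_spec (localSeries_succ_eq h2 D k) ξ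

end Prelim

/-! ## §2 Extensivity of the flow-action series -/

section Extensive

variable [Fintype Λ] [DecidableEq Λ] [Nonempty Λ] [Nontrivial E] {U : Λ → Λ → (E →L[ℝ] E)}

/-- **`Var_π̄(S̃⁽ᵏ⁾) ≤ |Λ|·(Δ+1)^{2(k+1)}·(κυ)^{2(k+1)}·A_k(d, Δ)` — THE ORDER-`k` TERM OF THE LOCAL
LÜSCHER SERIES OF THE LATTICE CP(N−1)/O(N) ACTION HAS EXTENSIVE FLUCTUATIONS.**  The variance under
the uniform product measure is at most linear in the number of sites, the constant depending on the
order `k`, `d = dim E`, the coordination bound `Δ` and the coupling size `κυ` only. -/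
theorem variance_localSeries_le (h2 : 2 ≤ Module.finrank ℝ E) (hU0 : ∀ n, U n n = 0)
    (hUadj : ∀ m n (v w : E), ⟪U m n v, w⟫ = ⟪v, U n m w⟫) (κ S₀ : ℝ) {υ : ℝ}
    (hυ : ∀ k, ∑ m, ‖U k m‖ ≤ υ) {Δ : ℕ} (hΔ : ∀ m, (couplingNbhd U m).ncard ≤ Δ) (k : ℕ) :
    ∫ ω, ((∑ n, localTerm h2 (esLocalAction hU0 hUadj κ S₀) k n
          (fun m => ((ω : Λ → sphere (0 : E) 1) m : E))) -
        ∫ ω', ∑ n, localTerm h2 (esLocalAction hU0 hUadj κ S₀) k n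
          (fun m => ((ω' : Λ → sphere (0 : E) 1) m : E))
          ∂Measure.pi (fun _ : Λ => uniformSphere (volume : Measure E))) ^ 2
        ∂Measure.pi (fun _ : Λ => uniformSphere (volume : Measure E)) ≤
      Fintype.card Λ * ((((Δ + 1) ^ (k + 1) * (Δ + 1) ^ (k + 1) : ℕ)) : ℝ) *
        ((κ * υ) ^ (2 * (k + 1)) * localVarConst (Module.finrank ℝ E) Δ k) :=
  variance_sum_le_of_local (uniformSphere (volume : Measure E))
    (couplingNbhd_symm hUadj) hΔ (k + 1)
    (fun n => continuous_localTerm_sphereConfig h2 hU0 hUadj κ S₀ k n)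
    (fun n => dependsOn_sphereConfig (localTerm_mem_es h2 hU0 hUadj κ S₀ k n).2)
    (fun n => variance_localTerm_le h2 hU0 hUadj κ S₀ hυ hΔ k n)

/-- **EXTENSIVITY FOR EVERY LÜSCHER SERIES OF THE E–S ACTION.**  Any family `(St' k)` of `C²`
functionals solving Lüscher's recursion for `S = esAction κ S₀ U` on the product of unit spheres
(order `0`: `−Σ∂̃²St'₀ = S + c'₀`; order `k+1`: `−Σ∂̃²St'_{k+1} = −Σ⟨∂̃S, ∂̃St'_k⟩ + c'_{k+1}`)
satisfies, at every order and for every finite `Λ`,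
`Var_π̄(St' k) ≤ |Λ|·(Δ+1)^{2(k+1)}·(κυ)^{2(k+1)}·A_k(d, Δ)`. -/
theorem variance_luscher_series_esAction_le (h2 : 2 ≤ Module.finrank ℝ E) (hU0 : ∀ n, U n n = 0)
    (hUadj : ∀ m n (v w : E), ⟪U m n v, w⟫ = ⟪v, U n m w⟫) (κ S₀ : ℝ) {υ : ℝ}
    (hυ : ∀ k, ∑ m, ‖U k m‖ ≤ υ) {Δ : ℕ} (hΔ : ∀ m, (couplingNbhd U m).ncard ≤ Δ)
    {St' : ℕ → (Λ → E) → ℝ} {c' : ℕ → ℝ} (hSt' : ∀ k, ContDiff ℝ 2 (St' k))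
    (h0' : ∀ ξ : Λ → sphere (0 : E) 1,
      -∑ n, siteLaplacian n (St' 0) (fun m => (ξ m : E)) =
        esAction κ S₀ U (fun m => (ξ m : E)) + c' 0)
    (hs' : ∀ k, ∀ ξ : Λ → sphere (0 : E) 1,
      -∑ n, siteLaplacian n (St' (k + 1)) (fun m => (ξ m : E)) =
        -(∑ n, ⟪siteGrad n (esAction κ S₀ U) (fun m => (ξ m : E)),
            siteGrad n (St' k) (fun m => (ξ m : E))⟫) + c' (k + 1)) (k : ℕ) :
    ∫ ω, (St' k (fun m => ((ω : Λ → sphere (0 : E) 1) m : E)) -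
        ∫ ω', St' k (fun m => ((ω' : Λ → sphere (0 : E) 1) m : E))
          ∂Measure.pi (fun _ : Λ => uniformSphere (volume : Measure E))) ^ 2
        ∂Measure.pi (fun _ : Λ => uniformSphere (volume : Measure E)) ≤
      Fintype.card Λ * ((((Δ + 1) ^ (k + 1) * (Δ + 1) ^ (k + 1) : ℕ)) : ℝ) *
        ((κ * υ) ^ (2 * (k + 1)) * localVarConst (Module.finrank ℝ E) Δ k) := by
  obtain ⟨c, h0, hs⟩ := localSeries_spec (Λ := Λ) h2 hU0 hUadj κ S₀
  have hsm : ∀ k, ContDiff ℝ 2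
      (fun x : Λ → E => ∑ n, localTerm h2 (esLocalAction hU0 hUadj κ S₀) k n x) := fun k =>
    polyS_contDiff_two _ _ (localSeries_mem_polyS h2 hU0 hUadj κ S₀ k)
  obtain ⟨-, d, hd⟩ := luscher_series_unique h2 hsm hSt' h0 h0' hs hs' k
  have hd' : ∀ ξ : Λ → sphere (0 : E) 1, St' k (fun m => (ξ m : E)) =
      (∑ n, localTerm h2 (esLocalAction hU0 hUadj κ S₀) k n (fun m => (ξ m : E))) - d :=
    fun ξ => by rw [hd ξ]; ring
  simp_rw [hd']
  rw [variance_sub_const (uniformSphere (volume : Measure E))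
    (continuous_finsetSum Finset.univ fun n _ => continuous_localTerm_sphereConfig h2 hU0 hUadj κ S₀ k n)]
  exact variance_localSeries_le h2 hU0 hUadj κ S₀ hυ hΔ k

end Extensive

/-! ## §3 The order-`k` generator, per site: bounded independently of the volume -/

section Generator

variable [Fintype Λ] [DecidableEq Λ] [Nonempty Λ] [Nontrivial E] {U : Λ → Λ → (E →L[ℝ] E)}

/-- **THE ORDER-`k` GENERATOR AT ONE SITE IS BOUNDED IN `L²(π̄)` INDEPENDENTLY OF THE VOLUME**:
for every site `j` and every finite `Λ`,
`∫‖∂̃_j S̃⁽ᵏ⁾‖² dπ̄ ≤ (Δ+1)^{2(k+1)} · M_k(M_k+d−2)·(κυ)^{2(k+1)}·A_k(d, Δ)` — only the `≤ (Δ+1)^{k+1}`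
anchors `n` with `j ∈ nball (k+1) n` contribute to `∂̃_j S̃⁽ᵏ⁾ = Σ_n ∂̃_j X_n⁽ᵏ⁾`, and each by at most
its Dirichlet bound. -/
theorem integral_norm_sq_siteGrad_localSeries_le (h2 : 2 ≤ Module.finrank ℝ E)
    (hU0 : ∀ n, U n n = 0) (hUadj : ∀ m n (v w : E), ⟪U m n v, w⟫ = ⟪v, U n m w⟫) (κ S₀ : ℝ)
    {υ : ℝ} (hυ : ∀ k, ∑ m, ‖U k m‖ ≤ υ) {Δ : ℕ} (hΔ : ∀ m, (couplingNbhd U m).ncard ≤ Δ)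
    (k : ℕ) (j : Λ) :
    ∫ ω, ‖siteGrad j (fun x => ∑ n, localTerm h2 (esLocalAction hU0 hUadj κ S₀) k n x)
        (fun m => ((ω : Λ → sphere (0 : E) 1) m : E))‖ ^ 2
        ∂Measure.pi (fun _ : Λ => uniformSphere (volume : Measure E)) ≤
      ((((Δ + 1) ^ (k + 1) * (Δ + 1) ^ (k + 1) : ℕ)) : ℝ) *
        (((2 * (k + 1) : ℝ) * (2 * (k + 1) + (Module.finrank ℝ E : ℝ) - 2)) *
          ((κ * υ) ^ (2 * (k + 1)) * localVarConst (Module.finrank ℝ E) Δ k)) := by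
  classical
  set μ : Measure (sphere (0 : E) 1) := uniformSphere (volume : Measure E) with hμ
  set D := esLocalAction hU0 hUadj κ S₀ with hD
  -- the Dirichlet bound per anchor, abbreviated
  set Dk : ℝ := ((2 * (k + 1) : ℝ) * (2 * (k + 1) + (Module.finrank ℝ E : ℝ) - 2)) *
    ((κ * υ) ^ (2 * (k + 1)) * localVarConst (Module.finrank ℝ E) Δ k) with hDk
  -- the anchors whose footprint contains `j`
  set T : Finset Λ := Finset.univ.filter fun n => j ∈ nball (couplingNbhd U) (k + 1) n with hT
  have hTsub : ∀ n ∈ T, n ∈ nball (couplingNbhd U) (k + 1) j := fun n hn =>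
    nball_symm (couplingNbhd_symm hUadj) (k + 1) (Finset.mem_filter.1 hn).2
  have hTcard : (T.card : ℝ) ≤ (((Δ + 1) ^ (k + 1) : ℕ) : ℝ) := by
    have h1 : T.card ≤ (Δ + 1) ^ (k + 1) := by
      calc T.card = (↑T : Set Λ).ncard := (ncard_coe_finset T).symm
        _ ≤ (nball (couplingNbhd U) (k + 1) j).ncard :=
            ncard_le_ncard (fun n hn => hTsub n (Finset.mem_coe.1 hn)) (toFinite _)
        _ ≤ (Δ + 1) ^ (k + 1) := ncard_nball_le hΔ j (k + 1)
    exact_mod_cast h1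
  -- on `Ω`, `∂̃_j S̃ = Σ_{n ∈ T} ∂̃_j X_n`
  have hgrad : ∀ ω : Λ → sphere (0 : E) 1,
      siteGrad j (fun x => ∑ n, localTerm h2 D k n x) (fun m => (ω m : E)) =
        ∑ n ∈ T, siteGrad j (localTerm h2 D k n) (fun m => (ω m : E)) := fun ω => by
    rw [siteGrad_sum Finset.univ (fun n _ => (localTerm_mem_es h2 hU0 hUadj κ S₀ k n).1) ω j]
    refine (Finset.sum_subset (Finset.subset_univ T) fun n _ hn => ?_).symm
    exact siteGrad_localTerm_eq_zero h2 hU0 hUadj κ S₀ k n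
      (fun h => hn (Finset.mem_filter.2 ⟨Finset.mem_univ _, h⟩)) _
  -- pointwise Cauchy–Schwarz: `‖Σ_{n∈T} a_n‖² ≤ |T| Σ_{n∈T} ‖a_n‖²`
  have hpt : ∀ ω : Λ → sphere (0 : E) 1,
      ‖siteGrad j (fun x => ∑ n, localTerm h2 D k n x) (fun m => (ω m : E))‖ ^ 2 ≤
        T.card * ∑ n ∈ T, ‖siteGrad j (localTerm h2 D k n) (fun m => (ω m : E))‖ ^ 2 := fun ω => by
    rw [hgrad ω]
    calc ‖∑ n ∈ T, siteGrad j (localTerm h2 D k n) (fun m => (ω m : E))‖ ^ 2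
        ≤ (∑ n ∈ T, ‖siteGrad j (localTerm h2 D k n) (fun m => (ω m : E))‖) ^ 2 :=
          pow_le_pow_left₀ (norm_nonneg _) (norm_sum_le _ _) 2
      _ ≤ _ := sq_sum_le_card_mul_sum_sq
  have hX1 : ∀ n, ContDiff ℝ 1 (localTerm h2 D k n) := fun n =>
    contDiff_infty.1 (contDiff_of_mem_polyS (localTerm_mem_es h2 hU0 hUadj κ S₀ k n).1) 1
  have hS1 : ContDiff ℝ 1 (fun x : Λ → E => ∑ n, localTerm h2 D k n x) :=
    contDiff_infty.1 (contDiff_of_mem_polyS (localSeries_mem_polyS h2 hU0 hUadj κ S₀ k)) 1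
  have hiL : Integrable (fun ω : Λ → sphere (0 : E) 1 =>
      ‖siteGrad j (fun x => ∑ n, localTerm h2 D k n x) (fun m => (ω m : E))‖ ^ 2)
      (Measure.pi fun _ : Λ => μ) :=
    integrable_pi_of_continuous μ ((continuous_siteGrad_sphereConfig hS1 j).norm.pow 2)
  have hiG : ∀ n, Integrable (fun ω : Λ → sphere (0 : E) 1 =>
      ‖siteGrad j (localTerm h2 D k n) (fun m => (ω m : E))‖ ^ 2) (Measure.pi fun _ : Λ => μ) :=
    fun n => integrable_pi_of_continuous μ ((continuous_siteGrad_sphereConfig (hX1 n) j).norm.pow 2)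
  have hiR : Integrable (fun ω : Λ → sphere (0 : E) 1 =>
      (T.card : ℝ) * ∑ n ∈ T, ‖siteGrad j (localTerm h2 D k n) (fun m => (ω m : E))‖ ^ 2)
      (Measure.pi fun _ : Λ => μ) := (integrable_finsetSum T fun n _ => hiG n).const_mul _
  have h1 := integral_mono hiL hiR hpt
  rw [integral_const_mul, integral_finsetSum T fun n _ => hiG n] at h1
  -- each anchor: `∫‖∂̃_j X_n‖² ≤ Σ_{j'} ∫‖∂̃_{j'} X_n‖² ≤ Dk`
  have hanchor : ∀ n, ∫ ω, ‖siteGrad j (localTerm h2 D k n) (fun m => ((ω : Λ → sphere (0 : E) 1) m : E))‖ ^ 2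
      ∂Measure.pi (fun _ : Λ => μ) ≤ Dk := fun n => by
    refine le_trans ?_ (dirichlet_localTerm_le h2 hU0 hUadj κ S₀ hυ hΔ k n)
    exact Finset.single_le_sum (f := fun j' => ∫ ω, ‖siteGrad j' (localTerm h2 D k n)
      (fun m => ((ω : Λ → sphere (0 : E) 1) m : E))‖ ^ 2 ∂Measure.pi (fun _ : Λ => μ))
      (fun j' _ => integral_nonneg fun ω => sq_nonneg _) (Finset.mem_univ j)
  have hDk0 : 0 ≤ Dk := (integral_nonneg fun ω => sq_nonneg _).trans (hanchor (Classical.arbitrary Λ))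
  calc _ ≤ (T.card : ℝ) * ∑ n ∈ T, ∫ ω, ‖siteGrad j (localTerm h2 D k n)
        (fun m => ((ω : Λ → sphere (0 : E) 1) m : E))‖ ^ 2 ∂Measure.pi (fun _ : Λ => μ) := h1
    _ ≤ (T.card : ℝ) * ∑ _n ∈ T, Dk :=
        mul_le_mul_of_nonneg_left (Finset.sum_le_sum fun n _ => hanchor n) (Nat.cast_nonneg _)
    _ = (T.card : ℝ) * (T.card * Dk) := by rw [Finset.sum_const, nsmul_eq_mul]
    _ ≤ (((Δ + 1) ^ (k + 1) : ℕ) : ℝ) * ((((Δ + 1) ^ (k + 1) : ℕ) : ℝ) * Dk) := by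
        gcongr
    _ = _ := by push_cast; ring

/-- **The same per-site bound for every `C²` Lüscher series of the E–S action**: on the product of
unit spheres the site gradient only sees the restriction to `Ω`, where any two series agree up to
constants order by order. -/
theorem integral_norm_sq_siteGrad_luscher_series_le (h2 : 2 ≤ Module.finrank ℝ E)
    (hU0 : ∀ n, U n n = 0) (hUadj : ∀ m n (v w : E), ⟪U m n v, w⟫ = ⟪v, U n m w⟫) (κ S₀ : ℝ)
    {υ : ℝ} (hυ : ∀ k, ∑ m, ‖U k m‖ ≤ υ) {Δ : ℕ} (hΔ : ∀ m, (couplingNbhd U m).ncard ≤ Δ)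
    {St' : ℕ → (Λ → E) → ℝ} {c' : ℕ → ℝ} (hSt' : ∀ k, ContDiff ℝ 2 (St' k))
    (h0' : ∀ ξ : Λ → sphere (0 : E) 1,
      -∑ n, siteLaplacian n (St' 0) (fun m => (ξ m : E)) =
        esAction κ S₀ U (fun m => (ξ m : E)) + c' 0)
    (hs' : ∀ k, ∀ ξ : Λ → sphere (0 : E) 1,
      -∑ n, siteLaplacian n (St' (k + 1)) (fun m => (ξ m : E)) =
        -(∑ n, ⟪siteGrad n (esAction κ S₀ U) (fun m => (ξ m : E)),
            siteGrad n (St' k) (fun m => (ξ m : E))⟫) + c' (k + 1)) (k : ℕ) (j : Λ) :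
    ∫ ω, ‖siteGrad j (St' k) (fun m => ((ω : Λ → sphere (0 : E) 1) m : E))‖ ^ 2
        ∂Measure.pi (fun _ : Λ => uniformSphere (volume : Measure E)) ≤
      ((((Δ + 1) ^ (k + 1) * (Δ + 1) ^ (k + 1) : ℕ)) : ℝ) *
        (((2 * (k + 1) : ℝ) * (2 * (k + 1) + (Module.finrank ℝ E : ℝ) - 2)) *
          ((κ * υ) ^ (2 * (k + 1)) * localVarConst (Module.finrank ℝ E) Δ k)) := by
  obtain ⟨c, h0, hs⟩ := localSeries_spec (Λ := Λ) h2 hU0 hUadj κ S₀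
  have hsm : ∀ k, ContDiff ℝ 2
      (fun x : Λ → E => ∑ n, localTerm h2 (esLocalAction hU0 hUadj κ S₀) k n x) := fun k =>
    polyS_contDiff_two _ _ (localSeries_mem_polyS h2 hU0 hUadj κ S₀ k)
  obtain ⟨-, d, hd⟩ := luscher_series_unique h2 hsm hSt' h0 h0' hs hs' k
  have hgrad : ∀ ω : Λ → sphere (0 : E) 1, siteGrad j (St' k) (fun m => (ω m : E)) =
      siteGrad j (fun x => ∑ n, localTerm h2 (esLocalAction hU0 hUadj κ S₀) k n x)
        (fun m => (ω m : E)) := fun ω =>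
    siteGrad_eq_of_forall_eq_add_const (c := -d) (fun ξ => by rw [hd ξ]; ring) ω j
  simp_rw [hgrad]
  exact integral_norm_sq_siteGrad_localSeries_le h2 hU0 hUadj κ S₀ hυ hΔ k j

end Generator

/-! ## §4 The CP(N−1) case of contractive transporters: the coupling weight is the coordination number -/

section UnitTransporters

variable [Fintype Λ] [DecidableEq Λ] [Nonempty Λ] [Nontrivial E] {U : Λ → Λ → (E →L[ℝ] E)}

omit [FiniteDimensional ℝ E] [MeasurableSpace E] [BorelSpace E] [DecidableEq Λ] [Nonempty Λ]
  [Nontrivial E] in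
/-- **Contractive transporters** (E–S's U(1) phases are isometries): if `‖U_{km}‖ ≤ 1` for all
`k, m` and every site has at most `Δ` partners, then the coupling weight `Σ_m ‖U_{km}‖` is `≤ Δ`. -/
theorem sum_opNorm_le_of_ncard_le (hU1 : ∀ k m, ‖U k m‖ ≤ 1) {Δ : ℕ}
    (hΔ : ∀ m, (couplingNbhd U m).ncard ≤ Δ) (k : Λ) : ∑ m, ‖U k m‖ ≤ Δ := by
  classical
  set B : Finset Λ := (toFinite (couplingNbhd U k)).toFinset with hB
  have hsum : ∑ m, ‖U k m‖ = ∑ m ∈ B, ‖U k m‖ := by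
    refine (Finset.sum_subset (Finset.subset_univ B) fun m _ hm => ?_).symm
    have h0 : U k m = 0 := by
      by_contra h
      exact hm ((Finite.mem_toFinset _).2 h)
    rw [h0, norm_zero]
  have hcard : B.card ≤ Δ := by
    rw [hB, ← ncard_eq_toFinset_card _ (toFinite _)]
    exact hΔ k
  rw [hsum]
  calc ∑ m ∈ B, ‖U k m‖ ≤ ∑ _m ∈ B, (1 : ℝ) := Finset.sum_le_sum fun m _ => hU1 k m
    _ = B.card := by rw [Finset.sum_const, nsmul_eq_mul, mul_one]
    _ ≤ Δ := by exact_mod_cast hcard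

/-- **EXTENSIVITY FOR THE LATTICE CP(N−1)/O(N) ACTION WITH CONTRACTIVE TRANSPORTERS**: with
`‖U_{km}‖ ≤ 1` (U(1) phases, or `0`) and at most `Δ` partners per site, EVERY `C²` Lüscher series of
`S = −κΣ_n⟪x_n, J_n⟫ + S₀` satisfies `Var_π̄(St' k) ≤ |Λ|·(Δ+1)^{2(k+1)}·(κΔ)^{2(k+1)}·A_k(d, Δ)` —
constants depending on `k`, `d`, `Δ`, `κ` only. -/
theorem variance_luscher_series_esAction_le_of_contractive (h2 : 2 ≤ Module.finrank ℝ E)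
    (hU0 : ∀ n, U n n = 0) (hUadj : ∀ m n (v w : E), ⟪U m n v, w⟫ = ⟪v, U n m w⟫)
    (hU1 : ∀ k m, ‖U k m‖ ≤ 1) (κ S₀ : ℝ) {Δ : ℕ} (hΔ : ∀ m, (couplingNbhd U m).ncard ≤ Δ)
    {St' : ℕ → (Λ → E) → ℝ} {c' : ℕ → ℝ} (hSt' : ∀ k, ContDiff ℝ 2 (St' k))
    (h0' : ∀ ξ : Λ → sphere (0 : E) 1,
      -∑ n, siteLaplacian n (St' 0) (fun m => (ξ m : E)) =
        esAction κ S₀ U (fun m => (ξ m : E)) + c' 0)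
    (hs' : ∀ k, ∀ ξ : Λ → sphere (0 : E) 1,
      -∑ n, siteLaplacian n (St' (k + 1)) (fun m => (ξ m : E)) =
        -(∑ n, ⟪siteGrad n (esAction κ S₀ U) (fun m => (ξ m : E)),
            siteGrad n (St' k) (fun m => (ξ m : E))⟫) + c' (k + 1)) (k : ℕ) :
    ∫ ω, (St' k (fun m => ((ω : Λ → sphere (0 : E) 1) m : E)) -
        ∫ ω', St' k (fun m => ((ω' : Λ → sphere (0 : E) 1) m : E))
          ∂Measure.pi (fun _ : Λ => uniformSphere (volume : Measure E))) ^ 2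
        ∂Measure.pi (fun _ : Λ => uniformSphere (volume : Measure E)) ≤
      Fintype.card Λ * ((((Δ + 1) ^ (k + 1) * (Δ + 1) ^ (k + 1) : ℕ)) : ℝ) *
        ((κ * Δ) ^ (2 * (k + 1)) * localVarConst (Module.finrank ℝ E) Δ k) :=
  variance_luscher_series_esAction_le h2 hU0 hUadj κ S₀ (sum_opNorm_le_of_ncard_le hU1 hΔ) hΔ
    hSt' h0' hs' k

/-- **The per-site generator bound with contractive transporters**: for every `C²` Lüscher series,
every site `j`, every finite `Λ`:
`∫‖∂̃_j St' k‖² dπ̄ ≤ (Δ+1)^{2(k+1)}·2(k+1)(2(k+1)+d−2)·(κΔ)^{2(k+1)}·A_k(d, Δ)`. -/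
theorem integral_norm_sq_siteGrad_luscher_series_le_of_contractive (h2 : 2 ≤ Module.finrank ℝ E)
    (hU0 : ∀ n, U n n = 0) (hUadj : ∀ m n (v w : E), ⟪U m n v, w⟫ = ⟪v, U n m w⟫)
    (hU1 : ∀ k m, ‖U k m‖ ≤ 1) (κ S₀ : ℝ) {Δ : ℕ} (hΔ : ∀ m, (couplingNbhd U m).ncard ≤ Δ)
    {St' : ℕ → (Λ → E) → ℝ} {c' : ℕ → ℝ} (hSt' : ∀ k, ContDiff ℝ 2 (St' k))
    (h0' : ∀ ξ : Λ → sphere (0 : E) 1,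
      -∑ n, siteLaplacian n (St' 0) (fun m => (ξ m : E)) =
        esAction κ S₀ U (fun m => (ξ m : E)) + c' 0)
    (hs' : ∀ k, ∀ ξ : Λ → sphere (0 : E) 1,
      -∑ n, siteLaplacian n (St' (k + 1)) (fun m => (ξ m : E)) =
        -(∑ n, ⟪siteGrad n (esAction κ S₀ U) (fun m => (ξ m : E)),
            siteGrad n (St' k) (fun m => (ξ m : E))⟫) + c' (k + 1)) (k : ℕ) (j : Λ) :
    ∫ ω, ‖siteGrad j (St' k) (fun m => ((ω : Λ → sphere (0 : E) 1) m : E))‖ ^ 2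
        ∂Measure.pi (fun _ : Λ => uniformSphere (volume : Measure E)) ≤
      ((((Δ + 1) ^ (k + 1) * (Δ + 1) ^ (k + 1) : ℕ)) : ℝ) *
        (((2 * (k + 1) : ℝ) * (2 * (k + 1) + (Module.finrank ℝ E : ℝ) - 2)) *
          ((κ * Δ) ^ (2 * (k + 1)) * localVarConst (Module.finrank ℝ E) Δ k)) :=
  integral_norm_sq_siteGrad_luscher_series_le h2 hU0 hUadj κ S₀ (sum_opNorm_le_of_ncard_le hU1 hΔ)
    hΔ hSt' h0' hs' k j

end UnitTransporters

end Summit.Ventures.LatticeQCDFlow.Exactness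

end
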